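import Summits.QuantumFields.BalabanUV.T4Continuum.Support.B13HistInsertionLoc
import Summits.QuantumFields.BalabanUV.T4Continuum.Support.B13HistDatum

/-!
# B13HistInsertionLocRead — row O1-c (HISTORY ∕ TABLES) of the NE5 crux O1, follower of `B13HistInsertionLoc`: the DICTIONARY
# between the per-read-out kernel budgets ∕ rate along the point evaluations of the history space of record and the PHYSICAL
# ENTRIES of `B13HistDatum` (weight × stored value) — the currency in which [II] Lemma 1 (1.36) p. 9 is printed (a bound PER ENTRY
# of the potential table against the entry's own level format) — and the W3 ∕ L03 ∕ W4 consumers in that currency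
# (cell `pub-balaban`, T⁴ fan-out, `HOME/t4/b2b-balaban-t4-ne5-p1/O1-CLAIM-TABLE-NE5-P1.md` row O1-c; owner rulings R22 ∕ R26;
# journal INTENT l.12170 — «NOT HERE» item of `B13HistInsertionLoc`'s header)

Unit `b2b-balaban-t4-ne5-formalise-leaf-06` (NE5 formalisation swarm, leaf prover 06, gen 2; row O1-c holder).  Summits-side NEW WORK
under the LEAN PLACEMENT RULE (cell modelling + bookkeeping; nothing of the manuscripts under audit is asserted; 0 cite tags).
HONEST FRAMING: rung (B)+1 of the FINITE-VOLUME T⁴ continuum programme — NOT infinite volume, NOT a mass gap, NOT the Clay problem,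
NOT a proof of NE5 (NOT PRINTED; cell GAPS G-t4-U3-1; spine 0/9 unchanged).  HONEST DEPENDENCY (cell line, verbatim): continuum YM
on T⁴ ⇐ BetaPertH ∧ nine spine estimates (0/9 proved); BetaPertH ⇐ (D1) ∧ (D4) ∧ CAP+tail; G-an2-4 gates asym, D1 and NE2/3/4.

WHY.  `B13HistInsertionLoc` (leaf-04-g2, owner item g30-g) takes the finite-rank class's AGE-FREE kernel binders along a norming
family `ρ` and, on a sup-normed table space `α →ᵇ ℂ`, along the point evaluations `evalCLM ℂ a` (§5 there).  The history space of
record `B13HistDatum.Hist F = Entry F →ᵇ ℂ` stores an entry `i : F.Idx` DIVIDED by its level format `F.wt i > 0` and reads it back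
physically as `F.read h i = F.wt i·h ⟨i⟩` (`HistFrame.norm_le_iff_read`: `‖h‖ ≤ μ ⟺ ∀ i, ‖F.read h i‖ ≤ μ·F.wt i`).  So a per-ENTRY
budget of the PHYSICAL read-outs of the kernels AGAINST THE ENTRY'S OWN LEVEL FORMAT — the shape in which (1.36) is printed
(`|𝐕″_k(Y, U, J, B)| ≤ E₀ε₁C₁M^q e^{C₂κ₁} exp(−(1−2δ)κd_k(Y))`: one domain `Y`, its own decay format) — IS the per-read-out budget
along `evalCLM`, and conversely.  This file types that dictionary (no new hypothesis shape: the physical budgets are written out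
as hypotheses) and restates the W3 ∕ L03 ∕ W4 consumers in the physical currency, BY NAME.

WHAT THIS FILE TYPES (bookkeeping ∕ [folklore]; 0 sorry):
* §1 `norm_evalCLM_eq_norm_read_div` (`‖evalCLM ⟨i⟩ h‖ = ‖F.read h i‖ ∕ F.wt i`), `sum_fibre_evalCLM_eq` (a weighted fibre sum of
  point-evaluation moduli at `⟨i⟩` = the weighted fibre sum of the physical read-outs of `i`, divided by `F.wt i`).
* §2 the dictionary, as EQUIVALENCES: `kerBudgetLoc_eval_iff_read`, `kerBudgetBLoc_eval_iff_read`, `kerRateLoc_eval_iff_read` —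
  `KerBudgetLoc K M W κ c (fun e => evalCLM ℂ e)` ⟺ `∀ …, ∀ i, Σ_{Y ∈ fibre k j} e^{−κd(Y)}·‖F.read (ker k (insOpA g U k) Y) i‖ ≤
  rHist k·c·F.wt i` (and the run-B ∕ rate twins).
* §3 consumers in the physical currency (through `B13HistInsertionLoc` §§2–5 with `norming_evalCLM`): `sliceBudget_of_kerReadBudget`
  (the P1 binder `InsDatum.SliceBudget`), `insScaleBoundLevel_of_kerReadBudget` ∕ `insScaleBound_of_kerReadBudget` (W3),
  `norm_sliceB_le_of_kerReadBudgetB` (the run-B slice bound `SliceBudgetB`'s body), `inBase_baseBudget_of_selfCtr_kerReadBudgetB`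
  (leaf L03 + `BaseBudget`, self-centred), `insertionRate_of_kerReadRates` (W4) — `c`, `δv` PER ENTRY, in units of the entry's level
  format per history margin.
STATUS (census, Edison rule).  Bookkeeping; discharges NO estimate of [II]; changes no census value (the reading of `c` ∕ `δv` as
per-entry constants is `B13HistInsertionLoc`'s; this file only names the physical currency).  No claim that Bałaban's insertion is
finite-rank (MODELLING NOTE of `B13HistInsertion`).  NE5 NOT PROVED; 0/12 leaves on Bałaban's concrete objects; spine 0/9; rung (B)+1
finite T⁴; NOT infinite volume ∕ mass gap ∕ Clay.  Axioms ⊆ {propext, Classical.choice, Quot.sound}.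
-/

noncomputable section

open scoped BigOperators
open Finset

namespace Summit.QuantumFields.BalabanUV.T4Continuum.B13HistInsertionLocRead

open Literature.MathematicalPhysics.QuantumFieldTheory.Balaban1983to89
open Literature.MathematicalPhysics.QuantumFieldTheory.Balaban1983to89.T4OutputRate (Carriers Functional DecayBound)
open Literature.MathematicalPhysics.QuantumFieldTheory.Balaban1983to89.T4InputCauchyRateData (StepModel)
open Literature.MathematicalPhysics.QuantumFieldTheory.Balaban1983to89.T4InputCauchyRateSpecies (BaseBudget)
open Summit.QuantumFields.BalabanUV.T4Continuum.InsertionLinearRate (LinearPair.BaseRate)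
open Summit.QuantumFields.BalabanUV.T4Continuum.InsertionLinearClassLoc (norming_evalCLM)
open Summit.QuantumFields.BalabanUV.T4Continuum.B13Base (selfBudgetBase selfCtr)
open Summit.QuantumFields.BalabanUV.T4Continuum.B13HistDatum (HistFrame Entry)
open Summit.QuantumFields.BalabanUV.T4Continuum.B13HistInsertion
open Summit.QuantumFields.BalabanUV.T4Continuum.B13HistInsertionRate.KernelDatum (linB)
open Summit.QuantumFields.BalabanUV.T4Continuum.B13HistInsertionLoc.KernelDatum (KerBudgetLoc KerBudgetBLoc KerRateLoc
  sliceBudget_of_kerBudgetLoc norm_sliceB_le_of_kerBudgetBLoc insScaleBoundLevel_of_kerBudgetLoc insScaleBound_of_kerBudget_eval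
  inBase_baseBudget_of_selfCtr_kerBudgetB_eval insertionRate_of_kernelRates_eval)

variable {C : Carriers} {IOp Op : Type*} [NormedAddCommGroup Op] [NormedSpace ℂ Op] {F : HistFrame C}

/-! ## §1 Point evaluations versus physical read-outs on the Hist of record -/

/-- [folklore] The point evaluation at the entry `⟨i⟩` and the PHYSICAL read-out of `i` differ by the (positive) weight:
`‖evalCLM ⟨i⟩ h‖ = ‖F.read h i‖ ∕ F.wt i`. -/
theorem norm_evalCLM_eq_norm_read_div (h : B13HistDatum.Hist F) (i : F.Idx) :
    ‖BoundedContinuousFunction.evalCLM ℂ (⟨i⟩ : Entry F) h‖ = ‖F.read h i‖ / F.wt i := by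
  rw [BoundedContinuousFunction.evalCLM_apply, HistFrame.read, norm_mul, Complex.norm_real, Real.norm_eq_abs,
    abs_of_pos (F.wt_pos i), mul_div_cancel_left₀ _ (F.wt_pos i).ne']

/-- [folklore] A weighted fibre sum of point-evaluation moduli at `⟨i⟩` is the weighted fibre sum of the physical read-outs of `i`
divided by the weight of `i`. -/
theorem sum_fibre_evalCLM_eq {κ : ℝ} (s : Finset C.Dom) (v : C.Dom → B13HistDatum.Hist F) (i : F.Idx) :
    ∑ Y ∈ s, Real.exp (-(κ * C.d Y)) * ‖BoundedContinuousFunction.evalCLM ℂ (⟨i⟩ : Entry F) (v Y)‖ =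
      (∑ Y ∈ s, Real.exp (-(κ * C.d Y)) * ‖F.read (v Y) i‖) / F.wt i := by
  rw [Finset.sum_div]
  refine Finset.sum_congr rfl fun Y _ => ?_
  rw [norm_evalCLM_eq_norm_read_div, mul_div_assoc]

namespace KernelDatum

variable {K : KernelDatum C IOp (B13HistDatum.Hist F)} {M : StepModel C Op (B13HistDatum.Hist F)} {W : Set (ℕ → ℝ)}

/-! ## §2 The dictionary: per-read-out budgets along `evalCLM` ⟺ per-entry physical budgets against the level format -/

/-- [folklore] **DICTIONARY (run A's kernel budget)**: `KerBudgetLoc` along the point evaluations of the Hist of record ⟺ for every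
entry `i`, `Σ_{Y ∈ fibre k j} e^{−κd(Y)}·‖F.read (ker k (insOpA g U k) Y) i‖ ≤ rHist k·c·F.wt i` — a per-ENTRY budget of the PHYSICAL
read-outs of the kernels against the entry's own level format (the currency of [II] (1.36) p. 9). -/
theorem kerBudgetLoc_eval_iff_read {κ c : ℝ} :
    KerBudgetLoc K M W κ c (fun e : Entry F => BoundedContinuousFunction.evalCLM ℂ e) ↔
      ∀ k, ∀ g ∈ W, ∀ (U : C.BgB) (j : ℕ), j < k → ∀ i : F.Idx,
        ∑ Y ∈ K.fibre k j, Real.exp (-(κ * C.d Y)) * ‖F.read (K.ker k (K.insOpA g U k) Y) i‖ ≤ M.rHist k * c * F.wt i := by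
  refine ⟨fun h k g hg U j hj i => ?_, fun h k g hg U j hj e => ?_⟩
  · have := h k g hg U j hj ⟨i⟩
    rwa [sum_fibre_evalCLM_eq, div_le_iff₀ (F.wt_pos i)] at this
  · obtain ⟨i⟩ := e
    rw [sum_fibre_evalCLM_eq, div_le_iff₀ (F.wt_pos i)]
    exact h k g hg U j hj i

/-- [folklore] **DICTIONARY (run B's kernel budget)**: the run-B twin of `kerBudgetLoc_eval_iff_read`. -/
theorem kerBudgetBLoc_eval_iff_read {κ c : ℝ} :
    KerBudgetBLoc K M W κ c (fun e : Entry F => BoundedContinuousFunction.evalCLM ℂ e) ↔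
      ∀ k, ∀ g ∈ W, ∀ (U : C.BgB) (j : ℕ), j < k → ∀ i : F.Idx,
        ∑ Y ∈ K.fibre k j, Real.exp (-(κ * C.d Y)) * ‖F.read (K.ker k (K.insOpB g U k) Y) i‖ ≤ M.rHist k * c * F.wt i := by
  refine ⟨fun h k g hg U j hj i => ?_, fun h k g hg U j hj e => ?_⟩
  · have := h k g hg U j hj ⟨i⟩
    rwa [sum_fibre_evalCLM_eq, div_le_iff₀ (F.wt_pos i)] at this
  · obtain ⟨i⟩ := e
    rw [sum_fibre_evalCLM_eq, div_le_iff₀ (F.wt_pos i)]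
    exact h k g hg U j hj i

/-- [folklore] **DICTIONARY (the kernel rate)**: `KerRateLoc` along the point evaluations ⟺ for every entry `i`,
`Σ_{Y ∈ fibre k j} e^{−κd(Y)}·‖F.read (ker k (insOpA g U k) Y − ker k (insOpB g U k) Y) i‖ ≤ δv·θ^k·rHist k·F.wt i`. -/
theorem kerRateLoc_eval_iff_read {κ δv θ : ℝ} :
    KerRateLoc K M W κ δv θ (fun e : Entry F => BoundedContinuousFunction.evalCLM ℂ e) ↔
      ∀ k, ∀ g ∈ W, ∀ (U : C.BgB) (j : ℕ), j < k → ∀ i : F.Idx,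
        ∑ Y ∈ K.fibre k j, Real.exp (-(κ * C.d Y)) * ‖F.read (K.ker k (K.insOpA g U k) Y - K.ker k (K.insOpB g U k) Y) i‖ ≤
          δv * θ ^ k * M.rHist k * F.wt i := by
  refine ⟨fun h k g hg U j hj i => ?_, fun h k g hg U j hj e => ?_⟩
  · have := h k g hg U j hj ⟨i⟩
    rwa [sum_fibre_evalCLM_eq, div_le_iff₀ (F.wt_pos i)] at this
  · obtain ⟨i⟩ := e
    rw [sum_fibre_evalCLM_eq, div_le_iff₀ (F.wt_pos i)]
    exact h k g hg U j hj i

/-! ## §3 The consumers in the physical currency (through `B13HistInsertionLoc`, `Norming` = `norming_evalCLM`) -/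

/-- [folklore] **THE P1 BINDER `SliceBudget` FROM A PER-ENTRY PHYSICAL KERNEL BUDGET** (`hbA` of the END face of record E1[rec] when
`S.D := K.toInsDatum` on the Hist of record): the run-A physical budget and `0 ≤ c` give `K.toInsDatum.SliceBudget M W κ c`. -/
theorem sliceBudget_of_kerReadBudget {κ c : ℝ}
    (hb : ∀ k, ∀ g ∈ W, ∀ (U : C.BgB) (j : ℕ), j < k → ∀ i : F.Idx,
      ∑ Y ∈ K.fibre k j, Real.exp (-(κ * C.d Y)) * ‖F.read (K.ker k (K.insOpA g U k) Y) i‖ ≤ M.rHist k * c * F.wt i)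
    (hc : 0 ≤ c) : K.toInsDatum.SliceBudget M W κ c :=
  sliceBudget_of_kerBudgetLoc norming_evalCLM (kerBudgetLoc_eval_iff_read.2 hb) hc

/-- [folklore] **W3 AT AN ARBITRARY LEVEL FROM A PER-ENTRY PHYSICAL KERNEL BUDGET**: run A's reading of the kernels, the run-A physical
budget, `0 ≤ c`, `0 ≤ ω` give `M.InsScaleBoundLevel W κ c K.ω` BY NAME — `c` per entry, in units of the level format per margin. -/
theorem insScaleBoundLevel_of_kerReadBudget {κ c : ℝ} (h : K.toInsDatum.ReadsA M W)
    (hb : ∀ k, ∀ g ∈ W, ∀ (U : C.BgB) (j : ℕ), j < k → ∀ i : F.Idx,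
      ∑ Y ∈ K.fibre k j, Real.exp (-(κ * C.d Y)) * ‖F.read (K.ker k (K.insOpA g U k) Y) i‖ ≤ M.rHist k * c * F.wt i)
    (hc : 0 ≤ c) (hω : 0 ≤ K.ω) : M.InsScaleBoundLevel W κ c K.ω :=
  insScaleBoundLevel_of_kerBudgetLoc norming_evalCLM h (kerBudgetLoc_eval_iff_read.2 hb) hc hω

/-- [folklore] **W3 AT THE REFERENCE LEVEL `E₁ ≥ 0`** (`StepModel.InsScaleBound`, cell gap G-ne5p1-3a″, BY NAME) from the same
physical budget. -/
theorem insScaleBound_of_kerReadBudget {κ E₁ c : ℝ} (h : K.toInsDatum.ReadsA M W)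
    (hb : ∀ k, ∀ g ∈ W, ∀ (U : C.BgB) (j : ℕ), j < k → ∀ i : F.Idx,
      ∑ Y ∈ K.fibre k j, Real.exp (-(κ * C.d Y)) * ‖F.read (K.ker k (K.insOpA g U k) Y) i‖ ≤ M.rHist k * c * F.wt i)
    (hc : 0 ≤ c) (hω : 0 ≤ K.ω) (hE₁ : 0 ≤ E₁) : M.InsScaleBound W κ E₁ c K.ω :=
  insScaleBound_of_kerBudget_eval h (kerBudgetLoc_eval_iff_read.2 hb) hc hω hE₁

/-- [folklore] **THE RUN-B SLICE BOUND FROM A PER-ENTRY PHYSICAL KERNEL BUDGET** (the body of the assembled END faces' `SliceBudgetB`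
binder `hbB`): the run-B physical budget, `0 ≤ c` give, for a scale-`j < k` table with entries `≤ T·e^{−κd}` (`T ≥ 0`),
`‖K.toInsDatum.slice k j (insOpB g U k) t‖ ≤ rHist k·(c·T)`. -/
theorem norm_sliceB_le_of_kerReadBudgetB {κ c : ℝ}
    (hb : ∀ k, ∀ g ∈ W, ∀ (U : C.BgB) (j : ℕ), j < k → ∀ i : F.Idx,
      ∑ Y ∈ K.fibre k j, Real.exp (-(κ * C.d Y)) * ‖F.read (K.ker k (K.insOpB g U k) Y) i‖ ≤ M.rHist k * c * F.wt i)
    (hc : 0 ≤ c) (k : ℕ) {g : ℕ → ℝ} (hg : g ∈ W) (U : C.BgB) {j : ℕ} {T : ℝ} {t : C.Dom → ℝ} (hj : j < k) (hT : 0 ≤ T)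
    (hbd : ∀ Y, C.scale Y = j → |t Y| ≤ T * Real.exp (-(κ * C.d Y))) :
    ‖K.toInsDatum.slice k j (K.toInsDatum.insOpB g U k) t‖ ≤ M.rHist k * (c * T) :=
  norm_sliceB_le_of_kerBudgetBLoc norming_evalCLM (kerBudgetBLoc_eval_iff_read.2 hb) hc k hg U hj hT hbd

/-- [folklore] **LEAF L03 ∧ `BaseBudget` FOR THE SELF-CENTRED INSTALLED MODEL FROM RUN B'S PER-ENTRY PHYSICAL KERNEL BUDGET**: run B's
reading of the kernels, the run-B physical budget, the printed level `DecayBound EB W E₀ κ` (leaf L06, displayed) and the signs give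
both faces for `M.withBase (selfBudgetBase M (linB K) E₀ c K.ω)` BY NAME — the history budget `E₀·rHist k·c∕(1 − ω)` is then PER ENTRY. -/
theorem inBase_baseBudget_of_selfCtr_kerReadBudgetB {EB : Functional C C.BgB} {κ E₀ c : ℝ} (hB : K.toInsDatum.ReadsB M W)
    (hb : ∀ k, ∀ g ∈ W, ∀ (U : C.BgB) (j : ℕ), j < k → ∀ i : F.Idx,
      ∑ Y ∈ K.fibre k j, Real.exp (-(κ * C.d Y)) * ‖F.read (K.ker k (K.insOpB g U k) Y) i‖ ≤ M.rHist k * c * F.wt i)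
    (hdB : DecayBound EB W E₀ κ) (hE₀ : 0 ≤ E₀) (hc : 0 ≤ c) (hω : 0 ≤ K.ω) (hω1 : K.ω < 1) :
    (M.withBase (selfBudgetBase M (linB K) E₀ c K.ω)).InBase EB W ∧
      BaseBudget (M.withBase (selfBudgetBase M (linB K) E₀ c K.ω)) W (selfCtr M (linB K).base) 0
        fun k => E₀ * (M.rHist k * (c / (1 - K.ω))) :=
  inBase_baseBudget_of_selfCtr_kerBudgetB_eval hB (kerBudgetBLoc_eval_iff_read.2 hb) hdB hE₀ hc hω hω1

/-- [folklore] **W4 FROM PER-ENTRY PHYSICAL KERNEL RATES**: both runs' readings of the kernels, the displayed NE2-TYPE `BaseRate δb θ`, the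
per-entry physical rate, `0 ≤ ω < 1`, `0 ≤ δv`, `0 ≤ θ`, `0 ≤ E₀` give `M.InsertionRate W κ E₀ (δb + E₀·(δv(1 − ω)⁻¹)) θ` BY NAME —
`δv` per entry, in units of the level format per margin. -/
theorem insertionRate_of_kerReadRates {κ E₀ δb δv θ : ℝ} (hA : K.toInsDatum.ReadsA M W) (hB : K.toInsDatum.ReadsB M W)
    (hbase : LinearPair.BaseRate K.linA (linB K) M W δb θ)
    (hr : ∀ k, ∀ g ∈ W, ∀ (U : C.BgB) (j : ℕ), j < k → ∀ i : F.Idx,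
      ∑ Y ∈ K.fibre k j, Real.exp (-(κ * C.d Y)) * ‖F.read (K.ker k (K.insOpA g U k) Y - K.ker k (K.insOpB g U k) Y) i‖ ≤
        δv * θ ^ k * M.rHist k * F.wt i)
    (hω : 0 ≤ K.ω) (hω1 : K.ω < 1) (hδ : 0 ≤ δv) (hθ : 0 ≤ θ) (hE₀ : 0 ≤ E₀) :
    M.InsertionRate W κ E₀ (δb + E₀ * (δv * (1 - K.ω)⁻¹)) θ :=
  insertionRate_of_kernelRates_eval hA hB hbase (kerRateLoc_eval_iff_read.2 hr) hω hω1 hδ hθ hE₀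

end KernelDatum

end Summit.QuantumFields.BalabanUV.T4Continuum.B13HistInsertionLocRead

end
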